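/-
Copyright: the b2b-balaban cell (near-miss cell 7), T⁴-continuum CRUX team (coordinator ruling e34b3e0c item (2)),
seat t4-ne7b-formalise-leaf-05 (gen 28). Released under the licence of the surrounding project.
-/
import Summits.QuantumFields.BalabanUV.T4Continuum.Spine.NE7b.NonAbelianStokesReading
import Summits.QuantumFields.BalabanUV.T4Continuum.Spine.NE7b.TornPureGauge

/-!
# W-hol: the hollow-domain witness — a flat exterior whose Type-II holonomy forces flux in every filling
# (route NE7b R-H ∕ C-RH°, `t4/ROUTES-NE7b.md` v7 Δv7 item 1 «WHEN DOES (TC) FAIL, AND WHAT THEN? Witness W-hol»;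
# §4∕§6 «[explicit construction]: W-hol», OFFERED not typed; PRICING-NE7b v8 F38 «W-hol ✓» priced by a float toy only)

Cell `pub-balaban`, sub-cell `t4`, spine estimate NE7b (node U5c), candidate route R-H «Peierls healing map». ROUTES-NE7b v7
answers the cross-check A-v6-1 with (NAS), (FF) — landed by leaf-01 as `NonAbelianStokesBound` ∕ `NonAbelianStokesReading` ∕
`NonAbelianStokesDisc` ∕ `NonAbelianStokesSU2` — and the topological condition (TC) «every collar loop null-homotopic in
`H ∪ coll` is null-homotopic in `coll`», which HOLDS for print's rectangular parallelepipeds ((TC-box), the decision (BOX))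
and FAILS for a hollow healing domain. The failure is exhibited by the witness **W-hol**: *«`H = A₁₂ × A₃₄ ⊂ T⁴` … a loop ON
`∂⁺H`, bounding the normal square `D ⊂ H` … every exterior plaquette variable is EXACTLY 1 … so `e` passes every cube-local
small-field test at every level with `a(e) = 0`, while `hol_γ(e) = exp(iσ₃θ)` … By (FF) every filling of `H` — num's
minimiser, den's minimiser, any competitor — has `max_H |U_p − 1| ≥ 2 sin(θ∕2)∕A`»*.

THIS FILE puts W-hol in the kernel, on `ℤ⁴`, for an ARBITRARY group element `g` (v7's `exp(iσ₃θ)`):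

* §1 = the companion toolkit `TornPureGauge` (any `d`, any group): `tornGauge lam S`, the pure gauge
  `(x, μ) ↦ lam x · (lam (x + e_μ))⁻¹` KEPT in the directions `μ ∈ S` and `1` in the others (the textbook «singular gauge
  transformation discontinuous on a Dirac volume» applied to `U ≡ 1`), with its line ∕ plaquette ∕ rectangle formulas and
  the vanishing criteria `plaquette_tornGauge_eq_one_of_periodic_i ∕ _j` (NO commutativity used anywhere).
* §2 (d = 4) **the witness** `whol g m := tornGauge (coreFn g m) {2, 3}` with `coreFn g m = g` on the solid lattice cube
  `[0, m)⁴` and `1` elsewhere — a thin vortex sheet on the lattice Clifford torus `∂[0,m)² × ∂[0,m)²`; the HOLLOW HOLE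
  OF THICKNESS `r`, `hole m r := A_r × A_r`, `A_r = [−1−r, m+r]² ∖ [1+r, m−2−r]²` (a product of two square annuli — the
  lattice `r`-thickening of the thin neighbourhood of the torus; v7's «10-layer S-thickening» is `r = 10` in cube units).
  **(W1) `plaquette_whol_eq_one_of_not_mem`**: every plaquette with a corner outside `hole m r` EQUALS `1`, for EVERY `r`
  (exact flatness of the exterior — `a(e) = 0` for every collar thickness and every cube-local test; the curvature sits on
  the mixed plaquettes straddling the torus, inside `hole m 0`). **(W2) `rectangle_whol_base`**: the `m × (2r+3)` rectangle
  `γ_r` in the mixed `(0, 2)`-plane based at `base r = (1+r, 1+r, −2−r, 1+r)` has holonomy `g`, and (`base_*_not_mem`) all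
  its sites lie OUTSIDE `hole m r` (`2r + 3 ≤ m`).
* §3 **fillings**: for every `U′` agreeing with `whol g m` on the links with both endpoints outside `hole m r`:
  `U′(γ_r) = g` (`rectangle_eq_of_agree`), the square's plaquettes not touching the hole stay `1`, hence over any
  `GaugeGroup` **(W3) `dist1_le_sum_of_agree`**: `dist1 g ≤ Σ_{s<m, t<2r+3} dist1 (U′(∂p_{02}(base r + s e₀ + t e₂)))`
  (leaf-01's (NAS) `dist1_rectangle_le_sum` BY NAME) and **`exists_forcedFlux_of_agree`**: some plaquette of the normal
  square TOUCHING the hole has `dist1 ≥ dist1 g ∕ (m(2r+3))` (leaf-01's (FF) `forcedFlux_rectangle` BY NAME, `a = 0`); and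
  **(W4) `not_exists_exteriorGauge`**: for `g ≠ 1` the exterior data are NOT a pure gauge on the exterior of `hole m r`,
  whatever `r` — (TC) fails for the hollow `H`, certified by holonomy (no `π₁` in the kernel; the Wilson loop is the
  certificate), and no collar thickness repairs it.
* §4 the reading on leaf-01's unit-quaternion carrier `sphereGaugeGroup` (`‖q − 1‖`; for v7's `h = exp(iσ₃θ)`,
  `‖h − 1‖ = 2 sin(θ∕2)`); on `SU(2)` §3 applies by instance resolution (`dist1 = ‖· − 1‖`, `BlockAveragingSU2.dist1_eq_norm`).

HONEST FRAMING. Law-free lattice gauge algebra about ONE explicit configuration of `ℤ⁴` and its fillings; no measure, no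
effective action, no constant of [Bałaban 1983–89] asserted or cited; nothing of bill A∕B's arithmetic, (MP<L²), (JC),
(LD-G), H1–H3. Under the decision (BOX) this is the NEGATIVE half of ROUTES v7 item 1 («print's parallelepiped rule is
load-bearing, not cosmetic») and moves NO grade. NE7b (`T4WeightBudget.RelWeightBound`) NOT PRINTED, NOT PROVED; spine PROVED
0∕9; rung (B)+1 on a FINITE torus T⁴ — NOT infinite volume, NOT the mass gap, NOT Clay. HONEST DEPENDENCY: continuum YM on
T⁴ ⇐ BetaPertH ∧ nine spine estimates (0/9 proved); BetaPertH ⇐ (D1) ∧ (D4) ∧ CAP+tail; G-an2-4 gates asym, D1 and NE2/3/4.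
POLICY: crux-route work under `Spine/NE7b/` (ROUTES v7 §6's named item W-hol, offered to whichever NE7b prover is seated;
coordinator FREEZE (0) respected: not a `T4Continuum/Support` leaf); concrete data definitions (`coreFn`, `kept`, `whol`, `base`,
the sets `cube` ∕ `sqAnn` ∕ `hole` describing OUR witness, with decidable membership), no `Prop`-valued definition,
no `[cite:]`.
-/

set_option autoImplicit false

namespace Summit.QuantumFields.BalabanUV.T4Continuum.NE7b.HollowForcedFluxWitness

noncomputable section

open Literature.MathematicalPhysics.QuantumFieldTheory.Balaban1983to89 (GaugeGroup dist1)
open Literature.MathematicalPhysics.QuantumFieldTheory (ZdGaugeConfig)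
open Summit.QuantumFields.BalabanUV.T4Continuum.NE7b.NonAbelianStokesReading
  (dist1_rectangle_le_sum forcedFlux_rectangle sphereGaugeGroup)
open Summit.QuantumFields.BalabanUV.T4Continuum.NE7b.TornPureGauge

/-! ## §2 The witness on `ℤ⁴`: a thin vortex sheet on the Clifford torus, flat off a hollow hole -/

section Witness

variable {G : Type*} [Group G]

/-- The solid lattice cube `[0, m)⁴ = D × D′` (`D = D′ = [0, m)²`), by four coordinate conditions. -/
def cube (m : ℕ) : Set (Fin 4 → ℤ) :=
  {x | (0 ≤ x 0 ∧ x 0 < m) ∧ (0 ≤ x 1 ∧ x 1 < m) ∧ (0 ≤ x 2 ∧ x 2 < m) ∧ (0 ≤ x 3 ∧ x 3 < m)}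

/-- Membership in `cube m`, unfolded. -/
theorem mem_cube_iff (m : ℕ) (x : Fin 4 → ℤ) :
    x ∈ cube m ↔ (0 ≤ x 0 ∧ x 0 < m) ∧ (0 ≤ x 1 ∧ x 1 < m) ∧ (0 ≤ x 2 ∧ x 2 < m) ∧ (0 ≤ x 3 ∧ x 3 < m) := Iff.rfl

/-- Membership in the cube is decidable (coordinate inequalities). -/
instance (m : ℕ) : DecidablePred (· ∈ cube m) := fun x => decidable_of_iff' _ (mem_cube_iff m x)

/-- The site function `g · 𝟙_{[0,m)⁴}` (values in `{1, g}`, so everything below is abelian in effect but proved without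
commutativity). -/
def coreFn (g : G) (m : ℕ) (x : Fin 4 → ℤ) : G := if x ∈ cube m then g else 1

/-- The kept directions `{2, 3}` (the `(2,3)`-plane `D′`); directions `0, 1` (the plane of `D`) are torn. -/
def kept : Finset (Fin 4) := {2, 3}

/-- **W-hol's configuration**: the pure gauge of `g · 𝟙_{[0,m)⁴}` torn in the directions `0, 1` — bond variables `≠ 1`
exactly on the `(2,3)`-bonds `(x, ν)` with `(x₀, x₁) ∈ [0,m)²` crossing `∂[0,m)²` in the `(2,3)`-plane (the Dirac volume
`D × ∂D′`); its curvature lives on the mixed plaquettes straddling the torus `∂D × ∂D′`. -/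
def whol (g : G) (m : ℕ) : ZdGaugeConfig 4 G := tornGauge (coreFn g m) kept

/-- The square annulus of thickness `r`: `A_r = [−1−r, m+r]² ∖ [1+r, m−2−r]²` of `ℤ²` (`2 + 2r` lattice layers around
`∂[0, m)²`; `r = 0` is the thinnest annulus carrying the sheet's plaquettes). -/
def sqAnn (m r : ℕ) : Set (ℤ × ℤ) :=
  {p | (-1 - (r : ℤ) ≤ p.1 ∧ p.1 ≤ m + r ∧ -1 - (r : ℤ) ≤ p.2 ∧ p.2 ≤ m + r) ∧
    ¬ (1 + (r : ℤ) ≤ p.1 ∧ p.1 ≤ (m : ℤ) - 2 - r ∧ 1 + (r : ℤ) ≤ p.2 ∧ p.2 ≤ (m : ℤ) - 2 - r)}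

/-- **THE HOLLOW HOLE of thickness `r`**, `H_r = A_r × A_r ⊂ ℤ⁴`: a product of two square annuli — the lattice
`r`-thickening of the thin neighbourhood `H_0` of the Clifford torus `∂D × ∂D′` (v7: «a 10-layer S-thickening of a thin
toroidal sheet»), `H_r ≅ T² × (square)`; the normal square links it, so its complement carries loops not contractible
in the complement — detected below by holonomy. -/
def hole (m r : ℕ) : Set (Fin 4 → ℤ) := {x | (x 0, x 1) ∈ sqAnn m r ∧ (x 2, x 3) ∈ sqAnn m r}

/-- Membership in `hole m r`, unfolded to the eight coordinate conditions. -/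
theorem mem_hole_iff (m r : ℕ) (x : Fin 4 → ℤ) :
    x ∈ hole m r ↔
      ((-1 - (r : ℤ) ≤ x 0 ∧ x 0 ≤ m + r ∧ -1 - (r : ℤ) ≤ x 1 ∧ x 1 ≤ m + r) ∧
        ¬ (1 + (r : ℤ) ≤ x 0 ∧ x 0 ≤ (m : ℤ) - 2 - r ∧ 1 + (r : ℤ) ≤ x 1 ∧ x 1 ≤ (m : ℤ) - 2 - r)) ∧
      ((-1 - (r : ℤ) ≤ x 2 ∧ x 2 ≤ m + r ∧ -1 - (r : ℤ) ≤ x 3 ∧ x 3 ≤ m + r) ∧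
        ¬ (1 + (r : ℤ) ≤ x 2 ∧ x 2 ≤ (m : ℤ) - 2 - r ∧ 1 + (r : ℤ) ≤ x 3 ∧ x 3 ≤ (m : ℤ) - 2 - r)) :=
  Iff.rfl

/-- Membership in the hole is decidable (coordinate inequalities). -/
instance (m r : ℕ) : DecidablePred (· ∈ hole m r) := fun x => decidable_of_iff' _ (mem_hole_iff m r x)

/-- The holes are nested in the thickness: `H_0 ⊆ H_r`. -/
theorem hole_zero_subset (m r : ℕ) : hole m 0 ⊆ hole m r := by
  intro x hx
  rw [mem_hole_iff] at hx ⊢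
  push_cast at hx ⊢
  omega

/-- `coreFn` sees only cube membership. -/
theorem coreFn_eq_of_iff (g : G) {m : ℕ} {a b : Fin 4 → ℤ} (h : a ∈ cube m ↔ b ∈ cube m) :
    coreFn g m a = coreFn g m b := by
  simp only [coreFn, h]

/-- **THE GEOMETRY OF THE VORTEX SHEET.** In a MIXED plane (one index torn, one kept), if cube membership jumps across BOTH
edges of the plaquette `∂p_{ij}(x)` in the sense negating both vanishing criteria, then all four corners of the plaquette lie
in the thinnest hole `H_0 = A_0 × A_0` (coordinate arithmetic: a jump across `e_i`, `i ∈ {0,1}`, puts `x_i ∈ {−1, m−1}`;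
across `e_j`, `j ∈ {2,3}`, puts `x_j ∈ {−1, m−1}`), hence in every `H_r`. -/
theorem corners_mem_hole_of_jumps (m r : ℕ) (x : Fin 4 → ℤ) (i j : Fin 4)
    (hij : (i ∉ kept ∧ j ∈ kept) ∨ (i ∈ kept ∧ j ∉ kept))
    (hA : ¬ ((x + Pi.single i 1 ∈ cube m ↔ x ∈ cube m) ∧
      (x + Pi.single i 1 + Pi.single j 1 ∈ cube m ↔ x + Pi.single j 1 ∈ cube m)))
    (hB : ¬ ((x + Pi.single j 1 ∈ cube m ↔ x ∈ cube m) ∧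
      (x + Pi.single i 1 + Pi.single j 1 ∈ cube m ↔ x + Pi.single i 1 ∈ cube m))) :
    x ∈ hole m r ∧ x + Pi.single i 1 ∈ hole m r ∧ x + Pi.single j 1 ∈ hole m r ∧
      x + Pi.single i 1 + Pi.single j 1 ∈ hole m r := by
  suffices h : x ∈ hole m 0 ∧ x + Pi.single i 1 ∈ hole m 0 ∧ x + Pi.single j 1 ∈ hole m 0 ∧
      x + Pi.single i 1 + Pi.single j 1 ∈ hole m 0 from
    ⟨hole_zero_subset m r h.1, hole_zero_subset m r h.2.1, hole_zero_subset m r h.2.2.1,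
      hole_zero_subset m r h.2.2.2⟩
  fin_cases i <;> fin_cases j <;>
    simp only [kept, Finset.mem_insert, Finset.mem_singleton, mem_hole_iff, mem_cube_iff, Pi.add_apply,
      Pi.single_apply] at hij hA hB ⊢ <;>
    simp at hij hA hB ⊢ <;> omega

/-- **(W1) EXACT FLATNESS OFF THE HOLE.** Every plaquette of `whol g m` with at least one corner outside `hole m r` equals
`1`: the exterior of the hollow hole is FLAT — `a(e) = 0` for every cube-local small-field test and every level — for EVERY
thickness `r` (any `m`, any group, any `g`). -/
theorem plaquette_whol_eq_one_of_not_mem (g : G) (m r : ℕ) (x : Fin 4 → ℤ) (i j : Fin 4)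
    (hx : x ∉ hole m r ∨ x + Pi.single i 1 ∉ hole m r ∨ x + Pi.single j 1 ∉ hole m r ∨
      x + Pi.single i 1 + Pi.single j 1 ∉ hole m r) :
    ZdGaugeConfig.plaquette (whol g m) x i j = 1 := by
  by_cases hA : (x + Pi.single i 1 ∈ cube m ↔ x ∈ cube m) ∧
      (x + Pi.single i 1 + Pi.single j 1 ∈ cube m ↔ x + Pi.single j 1 ∈ cube m)
  · exact plaquette_tornGauge_eq_one_of_periodic_i _ _ x i j (coreFn_eq_of_iff g hA.1) (coreFn_eq_of_iff g hA.2)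
  by_cases hB : (x + Pi.single j 1 ∈ cube m ↔ x ∈ cube m) ∧
      (x + Pi.single i 1 + Pi.single j 1 ∈ cube m ↔ x + Pi.single i 1 ∈ cube m)
  · exact plaquette_tornGauge_eq_one_of_periodic_j _ _ x i j (coreFn_eq_of_iff g hB.1) (coreFn_eq_of_iff g hB.2)
  by_cases hi : i ∈ kept <;> by_cases hj : j ∈ kept
  · exact plaquette_tornGauge_of_mem_of_mem _ _ hi hj x
  · obtain ⟨h0, h1, h2, h3⟩ := corners_mem_hole_of_jumps m r x i j (Or.inr ⟨hi, hj⟩) hA hB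
    exact (hx.elim (· h0) fun h => h.elim (· h1) fun h => h.elim (· h2) (· h3)).elim
  · obtain ⟨h0, h1, h2, h3⟩ := corners_mem_hole_of_jumps m r x i j (Or.inl ⟨hi, hj⟩) hA hB
    exact (hx.elim (· h0) fun h => h.elim (· h1) fun h => h.elim (· h2) (· h3)).elim
  · exact plaquette_tornGauge_of_not_mem_of_not_mem _ _ hi hj x

/-- Conversely the sheet is there (sanity, not used below): the mixed plaquette at the corner `(m−1, 0, m−1, 0)` of the
torus carries `g⁻¹` (`1 ≤ m`). -/
theorem plaquette_whol_corner (g : G) {m : ℕ} (hm : 1 ≤ m) :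
    ZdGaugeConfig.plaquette (whol g m) (fun k => if k = 0 ∨ k = 2 then (m : ℤ) - 1 else 0) 0 2 = g⁻¹ := by
  rw [whol, plaquette_tornGauge_of_not_mem_of_mem _ _ (by decide) (by decide)]
  have h0 : (fun k : Fin 4 => if k = 0 ∨ k = 2 then (m : ℤ) - 1 else 0) ∈ cube m := by
    simp only [mem_cube_iff]; simp; omega
  have h1 : ¬ (fun k : Fin 4 => if k = 0 ∨ k = 2 then (m : ℤ) - 1 else 0) + Pi.single 0 1 ∈ cube m := by
    simp only [mem_cube_iff, Pi.add_apply, Pi.single_apply]; simp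
  have h2 : ¬ (fun k : Fin 4 => if k = 0 ∨ k = 2 then (m : ℤ) - 1 else 0) + Pi.single 0 1 + Pi.single 2 1 ∈ cube m := by
    simp only [mem_cube_iff, Pi.add_apply, Pi.single_apply]; simp
  have h3 : ¬ (fun k : Fin 4 => if k = 0 ∨ k = 2 then (m : ℤ) - 1 else 0) + Pi.single 2 1 ∈ cube m := by
    simp only [mem_cube_iff, Pi.add_apply, Pi.single_apply]; simp
  simp [coreFn, h0, h1, h2, h3]

/-- The base point `x⋆_r = (1+r, 1+r, −2−r, 1+r)` of the loop `γ_r`: `(x₀, x₁) = (1+r, 1+r)` deep inside `D`,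
`(x₂, x₃) = (−2−r, 1+r)` far outside `D′`. -/
def base (r : ℕ) : Fin 4 → ℤ := fun k => if k = 2 then -2 - (r : ℤ) else 1 + r

/-- **(W2) TYPE-II HOLONOMY.** The `m × (2r+3)` rectangle `γ_r` in the mixed `(0, 2)`-plane based at `x⋆_r` has holonomy
EXACTLY `g` (`2r + 3 ≤ m`): its two kept sides telescope to `coreFn` at the four corners, of which only
`x⋆_r + (2r+3)e₂ = (1+r, 1+r, 1+r, 1+r)` is in the cube. -/
theorem rectangle_whol_base (g : G) {m r : ℕ} (hm : 2 * r + 3 ≤ m) :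
    ZdGaugeConfig.rectangle (whol g m) (base r) 0 2 m (2 * r + 3) = g := by
  rw [whol, rectangle_tornGauge_of_not_mem_of_mem _ _ (by decide) (by decide)]
  have h1 : ¬ base r + Pi.single 0 (m : ℤ) ∈ cube m := by
    simp only [mem_cube_iff, base, Pi.add_apply, Pi.single_apply]; simp; omega
  have h2 : ¬ base r + Pi.single 0 (m : ℤ) + Pi.single 2 ((2 * r + 3 : ℕ) : ℤ) ∈ cube m := by
    simp only [mem_cube_iff, base, Pi.add_apply, Pi.single_apply]; simp; omega
  have h3 : base r + Pi.single 2 ((2 * r + 3 : ℕ) : ℤ) ∈ cube m := by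
    simp only [mem_cube_iff, base, Pi.add_apply, Pi.single_apply]; simp; omega
  have h4 : ¬ base r ∈ cube m := by
    simp only [mem_cube_iff, base]; simp; omega
  simp only [coreFn, if_neg h1, if_neg h2, if_pos h3, if_neg h4, inv_one, mul_one, one_mul]

/-- The bottom side of `γ_r` (and beyond): `x⋆_r + s e₀ ∉ hole m r` for every `s` (its `(2,3)`-part `(−2−r, 1+r)` is outside `A_r`). -/
theorem base_add_not_mem (m r s : ℕ) : base r + Pi.single 0 (s : ℤ) ∉ hole m r := by
  simp only [mem_hole_iff, base, Pi.add_apply, Pi.single_apply]; simp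

/-- The top side of `γ_r`: `x⋆_r + (2r+3)e₂ + s e₀ ∉ hole m r` (`(2,3)`-part `(1+r, 1+r)` deep inside; needs `2r+3 ≤ m`). -/
theorem base_top_add_not_mem {m r : ℕ} (hm : 2 * r + 3 ≤ m) (s : ℕ) :
    base r + Pi.single 2 ((2 * r + 3 : ℕ) : ℤ) + Pi.single 0 (s : ℤ) ∉ hole m r := by
  simp only [mem_hole_iff, base, Pi.add_apply, Pi.single_apply]; simp; omega

/-- The left side of `γ_r`: `x⋆_r + t e₂ ∉ hole m r` (`(0,1)`-part `(1+r, 1+r)` deep inside; needs `2r+3 ≤ m`). -/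
theorem base_add_two_not_mem {m r : ℕ} (hm : 2 * r + 3 ≤ m) (t : ℕ) : base r + Pi.single 2 (t : ℤ) ∉ hole m r := by
  simp only [mem_hole_iff, base, Pi.add_apply, Pi.single_apply]; simp; omega

/-- The right side of `γ_r`: `x⋆_r + m e₀ + t e₂ ∉ hole m r` (`(0,1)`-part `(1+r+m, 1+r)` far outside). -/
theorem base_right_add_not_mem (m r t : ℕ) : base r + Pi.single 0 (m : ℤ) + Pi.single 2 (t : ℤ) ∉ hole m r := by
  simp only [mem_hole_iff, base, Pi.add_apply, Pi.single_apply]; simp; omega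

/-! ## §3 Fillings: agreement off the hole transports the holonomy; (NAS)∕(FF) force the flux -/

/-- Straight-line holonomies depend only on the bonds of the line. -/
theorem line_congr {d : ℕ} {U U' : ZdGaugeConfig d G} (k : Fin d) :
    ∀ (n : ℕ) (y : Fin d → ℤ), (∀ t : ℕ, t < n → U' (y + Pi.single k (t : ℤ), k) = U (y + Pi.single k (t : ℤ), k)) →
      ZdGaugeConfig.line U' k n y = ZdGaugeConfig.line U k n y
  | 0, _, _ => rfl
  | n + 1, y, h => by
    rw [ZdGaugeConfig.line, ZdGaugeConfig.line]
    have h0 : U' (y, k) = U (y, k) := by simpa using h 0 (Nat.succ_pos n)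
    rw [h0, line_congr k n (y + Pi.single k 1) fun t ht => ?_]
    rw [add_single_one_add_single]
    exact h (t + 1) (Nat.succ_lt_succ ht)

/-- A FILLING of the hole: a configuration `U'` agreeing with `whol g m` on every bond with both endpoints outside
`hole m r`. A straight line all of whose sites are outside the hole has the same holonomy in every filling. -/
theorem line_eq_of_agree {g : G} {m r : ℕ} {U' : ZdGaugeConfig 4 G}
    (hU' : ∀ (y : Fin 4 → ℤ) (μ : Fin 4), y ∉ hole m r → y + Pi.single μ 1 ∉ hole m r → U' (y, μ) = whol g m (y, μ))
    (k : Fin 4) (n : ℕ) (y : Fin 4 → ℤ) (hy : ∀ t : ℕ, t ≤ n → y + Pi.single k (t : ℤ) ∉ hole m r) :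
    ZdGaugeConfig.line U' k n y = ZdGaugeConfig.line (whol g m) k n y :=
  line_congr k n y fun t ht => hU' _ _ (hy t ht.le) (by rw [add_single_add_single_one]; exact hy (t + 1) ht)

/-- **THE LOOP IS EXTERIOR, SO ITS HOLONOMY IS DATA**: every filling has `U'(γ_r) = g` (`2r + 3 ≤ m`). -/
theorem rectangle_eq_of_agree (g : G) {m r : ℕ} (hm : 2 * r + 3 ≤ m) {U' : ZdGaugeConfig 4 G}
    (hU' : ∀ (y : Fin 4 → ℤ) (μ : Fin 4), y ∉ hole m r → y + Pi.single μ 1 ∉ hole m r → U' (y, μ) = whol g m (y, μ)) :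
    ZdGaugeConfig.rectangle U' (base r) 0 2 m (2 * r + 3) = g := by
  rw [← rectangle_whol_base g hm, ZdGaugeConfig.rectangle, ZdGaugeConfig.rectangle,
    line_eq_of_agree hU' 0 m _ (fun s _ => base_add_not_mem m r s),
    line_eq_of_agree hU' 2 (2 * r + 3) _ (fun t _ => base_right_add_not_mem m r t),
    line_eq_of_agree hU' 0 m _ (fun s _ => base_top_add_not_mem hm s),
    line_eq_of_agree hU' 2 (2 * r + 3) _ (fun t _ => base_add_two_not_mem hm t)]

/-- Plaquettes depend only on their four bonds. -/
theorem plaquette_congr {d : ℕ} {U U' : ZdGaugeConfig d G} (x : Fin d → ℤ) (i j : Fin d) (h1 : U' (x, i) = U (x, i))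
    (h2 : U' (x + Pi.single i 1, j) = U (x + Pi.single i 1, j)) (h3 : U' (x + Pi.single j 1, i) = U (x + Pi.single j 1, i))
    (h4 : U' (x, j) = U (x, j)) : ZdGaugeConfig.plaquette U' x i j = ZdGaugeConfig.plaquette U x i j := by
  simp only [ZdGaugeConfig.plaquette, h1, h2, h3, h4]

/-- A plaquette none of whose corners is in the hole is EXTERIOR: every filling reads it as `whol` does, i.e. as `1`. -/
theorem plaquette_eq_one_of_agree {g : G} {m r : ℕ} {U' : ZdGaugeConfig 4 G}
    (hU' : ∀ (y : Fin 4 → ℤ) (μ : Fin 4), y ∉ hole m r → y + Pi.single μ 1 ∉ hole m r → U' (y, μ) = whol g m (y, μ))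
    (x : Fin 4 → ℤ) (i j : Fin 4) (h0 : x ∉ hole m r) (hi : x + Pi.single i 1 ∉ hole m r)
    (hj : x + Pi.single j 1 ∉ hole m r) (hij : x + Pi.single i 1 + Pi.single j 1 ∉ hole m r) :
    ZdGaugeConfig.plaquette U' x i j = 1 := by
  rw [plaquette_congr x i j (hU' _ _ h0 hi) (hU' _ _ hi hij)
    (hU' _ _ hj (by rw [add_right_comm]; exact hij)) (hU' _ _ h0 hj)]
  exact plaquette_whol_eq_one_of_not_mem g m r x i j (Or.inl h0)

/-- **(W4) (TC) FAILS FOR THE HOLLOW HOLE, certified by holonomy**: for `g ≠ 1` the exterior data of `whol g m` are NOT a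
pure gauge on the bonds exterior to `hole m r` (a pure gauge `tornGauge φ univ` agreeing with them off the hole would be a
filling with `U'(γ_r) = 1`; but every filling has `U'(γ_r) = g`) — for EVERY thickness `r` with `2r + 3 ≤ m`: thickening
the collar does not help, the flat exterior of a torus-shaped hole is never gauge-trivial. -/
theorem not_exists_exteriorGauge {g : G} {m r : ℕ} (hm : 2 * r + 3 ≤ m) (hg : g ≠ 1) :
    ¬ ∃ φ : (Fin 4 → ℤ) → G, ∀ (y : Fin 4 → ℤ) (μ : Fin 4), y ∉ hole m r → y + Pi.single μ 1 ∉ hole m r →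
      whol g m (y, μ) = φ y * (φ (y + Pi.single μ 1))⁻¹ := by
  rintro ⟨φ, hφ⟩
  have h := rectangle_eq_of_agree g hm (U' := tornGauge φ Finset.univ) fun y μ hy hy' => by
    rw [tornGauge_apply_of_mem _ _ (Finset.mem_univ μ), hφ y μ hy hy']
  rw [rectangle_tornGauge_of_mem_of_mem _ _ (Finset.mem_univ _) (Finset.mem_univ _)] at h
  exact hg h.symm

variable {G : Type*} [GaugeGroup G]

/-- **(W3) FORCED FLUX, SUM FORM.** In every filling of the hollow hole the normal square carries total curvature size at
least `dist1 g`: `dist1 g ≤ Σ_{s<m} Σ_{t<2r+3} dist1 (U'(∂p_{02}(x⋆_r + s e₀ + t e₂)))` — leaf-01's (NAS)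
`dist1_rectangle_le_sum` on `U'` with `U'(γ_r) = g`. Num's minimiser, den's minimiser and any competitor alike: «the joint
near-flat filling does not exist». -/
theorem dist1_le_sum_of_agree (g : G) {m r : ℕ} (hm : 2 * r + 3 ≤ m) {U' : ZdGaugeConfig 4 G}
    (hU' : ∀ (y : Fin 4 → ℤ) (μ : Fin 4), y ∉ hole m r → y + Pi.single μ 1 ∉ hole m r → U' (y, μ) = whol g m (y, μ)) :
    dist1 g ≤ ∑ s ∈ Finset.range m, ∑ t ∈ Finset.range (2 * r + 3),
      dist1 (ZdGaugeConfig.plaquette U' (base r + Pi.single 0 (s : ℤ) + Pi.single 2 (t : ℤ)) 0 2) := by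
  have h := dist1_rectangle_le_sum U' (base r) 0 2 m (2 * r + 3)
  rwa [rectangle_eq_of_agree g hm hU'] at h

/-- **(W3′) FORCED FLUX, PIGEONHOLE FORM** (leaf-01's (FF) `forcedFlux_rectangle` with `a = 0`): in every filling some
plaquette of the normal square TOUCHING THE HOLE has `dist1 ≥ dist1 g ∕ (m(2r+3))` (the plaquettes not touching it are
exterior and read `1`; v7's floor `|h − 1| ∕ A` with `A ≤ m(2r+3)`). -/
theorem exists_forcedFlux_of_agree (g : G) {m r : ℕ} (hm : 2 * r + 3 ≤ m) {U' : ZdGaugeConfig 4 G}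
    (hU' : ∀ (y : Fin 4 → ℤ) (μ : Fin 4), y ∉ hole m r → y + Pi.single μ 1 ∉ hole m r → U' (y, μ) = whol g m (y, μ)) :
    ∃ s t : ℕ, s < m ∧ t < 2 * r + 3 ∧
      (base r + Pi.single 0 (s : ℤ) + Pi.single 2 (t : ℤ) ∈ hole m r ∨
        base r + Pi.single 0 (s : ℤ) + Pi.single 2 (t : ℤ) + Pi.single 0 1 ∈ hole m r ∨
        base r + Pi.single 0 (s : ℤ) + Pi.single 2 (t : ℤ) + Pi.single 2 1 ∈ hole m r ∨
        base r + Pi.single 0 (s : ℤ) + Pi.single 2 (t : ℤ) + Pi.single 0 1 + Pi.single 2 1 ∈ hole m r) ∧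
      dist1 g / (m * (2 * r + 3)) ≤
        dist1 (ZdGaugeConfig.plaquette U' (base r + Pi.single 0 (s : ℤ) + Pi.single 2 (t : ℤ)) 0 2) := by
  let inH : ℕ × ℕ → Prop := fun st =>
    base r + Pi.single 0 (st.1 : ℤ) + Pi.single 2 (st.2 : ℤ) ∈ hole m r ∨
      base r + Pi.single 0 (st.1 : ℤ) + Pi.single 2 (st.2 : ℤ) + Pi.single 0 1 ∈ hole m r ∨
      base r + Pi.single 0 (st.1 : ℤ) + Pi.single 2 (st.2 : ℤ) + Pi.single 2 1 ∈ hole m r ∨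
      base r + Pi.single 0 (st.1 : ℤ) + Pi.single 2 (st.2 : ℤ) + Pi.single 0 1 + Pi.single 2 1 ∈ hole m r
  -- the plaquette `(m − 1, 0)` touches the hole through its corner `x⋆_r + (m−1)e₀ + e₂ = (m+r, 1+r, −1−r, 1+r)`
  have hmem : (m - 1, 0) ∈ (Finset.range m ×ˢ Finset.range (2 * r + 3)).filter inH := by
    refine Finset.mem_filter.mpr ⟨Finset.mem_product.mpr ⟨Finset.mem_range.mpr (by omega), Finset.mem_range.mpr
      (by omega)⟩, Or.inr (Or.inr (Or.inl ?_))⟩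
    simp only [mem_hole_iff, base, Pi.add_apply, Pi.single_apply]; simp; omega
  have hH : ((Finset.range m ×ˢ Finset.range (2 * r + 3)).filter inH).Nonempty := ⟨_, hmem⟩
  have hcoll : ∀ st ∈ Finset.range m ×ˢ Finset.range (2 * r + 3), ¬ inH st →
      dist1 (ZdGaugeConfig.plaquette U' (base r + Pi.single 0 (st.1 : ℤ) + Pi.single 2 (st.2 : ℤ)) 0 2) ≤ 0 := by
    intro st _ hst
    simp only [inH, not_or] at hst
    rw [plaquette_eq_one_of_agree hU' _ 0 2 hst.1 hst.2.1 hst.2.2.1 hst.2.2.2, GaugeGroup.dist1_one]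
  obtain ⟨st, hst, hle⟩ := forcedFlux_rectangle U' (base r) 0 2 m (2 * r + 3) inH hH hcoll
  rw [rectangle_eq_of_agree g hm hU', mul_zero, sub_zero] at hle
  obtain ⟨hst1, hst2⟩ := Finset.mem_filter.mp hst
  obtain ⟨hs, ht⟩ := Finset.mem_product.mp hst1
  refine ⟨st.1, st.2, Finset.mem_range.mp hs, Finset.mem_range.mp ht, hst2, le_trans ?_ hle⟩
  have hcard : (((Finset.range m ×ˢ Finset.range (2 * r + 3)).filter inH).card : ℝ) ≤ m * (2 * r + 3) := by
    have h := Finset.card_filter_le (Finset.range m ×ˢ Finset.range (2 * r + 3)) inH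
    rw [Finset.card_product, Finset.card_range, Finset.card_range] at h
    exact_mod_cast h
  have hpos : (0 : ℝ) < ((Finset.range m ×ˢ Finset.range (2 * r + 3)).filter inH).card :=
    Nat.cast_pos.mpr hH.card_pos
  exact div_le_div_of_nonneg_left (GaugeGroup.dist1_nonneg g) hpos hcard

end Witness

/-! ## §4 The reading on the unit quaternions `S³` (carrier of the PH-k chain) -/

section Sphere

open Quaternion

/-- **W-hol ON `S³`-VALUED CONFIGURATIONS**, plain norm form: for every unit quaternion `q` (v7: `q ↔ exp(iσ₃θ)`,
`‖q − 1‖ = 2 sin(θ∕2)`), every thickness `r` with `2r + 3 ≤ m`, and every filling `U'` of the hollow hole agreeing with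
`whol q m` off it, `‖q − 1‖ ≤ Σ_{s<m} Σ_{t<2r+3} ‖U'(∂p_{02}(x⋆_r + s e₀ + t e₂)) − 1‖`. -/
theorem sphere_norm_sub_one_le_sum_of_agree (q : Metric.sphere (0 : ℍ) 1) {m r : ℕ} (hm : 2 * r + 3 ≤ m)
    {U' : ZdGaugeConfig 4 (Metric.sphere (0 : ℍ) 1)}
    (hU' : ∀ (y : Fin 4 → ℤ) (μ : Fin 4), y ∉ hole m r → y + Pi.single μ 1 ∉ hole m r → U' (y, μ) = whol q m (y, μ)) :
    ‖(q : ℍ) - 1‖ ≤ ∑ s ∈ Finset.range m, ∑ t ∈ Finset.range (2 * r + 3),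
      ‖((ZdGaugeConfig.plaquette U' (base r + Pi.single 0 (s : ℤ) + Pi.single 2 (t : ℤ)) 0 2 :
        Metric.sphere (0 : ℍ) 1) : ℍ) - 1‖ := by
  letI : GaugeGroup (Metric.sphere (0 : ℍ) 1) := sphereGaugeGroup
  exact dist1_le_sum_of_agree q hm hU'

/-- … and the pigeonhole form: some plaquette of the normal square touching the hole has
`‖U'_p − 1‖ ≥ ‖q − 1‖ ∕ (m(2r+3))`. -/
theorem sphere_exists_forcedFlux_of_agree (q : Metric.sphere (0 : ℍ) 1) {m r : ℕ} (hm : 2 * r + 3 ≤ m)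
    {U' : ZdGaugeConfig 4 (Metric.sphere (0 : ℍ) 1)}
    (hU' : ∀ (y : Fin 4 → ℤ) (μ : Fin 4), y ∉ hole m r → y + Pi.single μ 1 ∉ hole m r → U' (y, μ) = whol q m (y, μ)) :
    ∃ s t : ℕ, s < m ∧ t < 2 * r + 3 ∧
      (base r + Pi.single 0 (s : ℤ) + Pi.single 2 (t : ℤ) ∈ hole m r ∨
        base r + Pi.single 0 (s : ℤ) + Pi.single 2 (t : ℤ) + Pi.single 0 1 ∈ hole m r ∨
        base r + Pi.single 0 (s : ℤ) + Pi.single 2 (t : ℤ) + Pi.single 2 1 ∈ hole m r ∨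
        base r + Pi.single 0 (s : ℤ) + Pi.single 2 (t : ℤ) + Pi.single 0 1 + Pi.single 2 1 ∈ hole m r) ∧
      ‖(q : ℍ) - 1‖ / (m * (2 * r + 3)) ≤
        ‖((ZdGaugeConfig.plaquette U' (base r + Pi.single 0 (s : ℤ) + Pi.single 2 (t : ℤ)) 0 2 :
          Metric.sphere (0 : ℍ) 1) : ℍ) - 1‖ := by
  letI : GaugeGroup (Metric.sphere (0 : ℍ) 1) := sphereGaugeGroup
  exact exists_forcedFlux_of_agree q hm hU'

end Sphere

end

end Summit.QuantumFields.BalabanUV.T4Continuum.NE7b.HollowForcedFluxWitness
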